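import Mathlib
import Summits.KontsevichZagierPeriods.KontsevichZagierPeriods.Theorems.SoloInformedKummerHeumanProfile
import Summits.KontsevichZagierPeriods.KontsevichZagierPeriods.Theorems.SoloInformedKummerZetaBand
import HarnessLib
import HarnessLib.Audit

/-!
# Kummer family V: the circular reciprocity law for the third kind, III — the band (s41)

Third file of THEOREM XXVIII(b) of the residency paper (§6quattuordecies; files I–II =
`SoloInformedKummerHeumanKernel`, `SoloInformedKummerHeumanProfile`).  Measure-theoretic input
for the two moves of file IV, in the amplitude coordinates `(x,s)` (modulus `m` for `x`,
complementary modulus `1 − m` for `s`):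

* `ℚ`-semialgebraicity of the deformation potential `Ψ(w₀,w₁)` and of its `s`-derivative
  `R(w₀,w₁)κ(w₀)κ'(w₁)` on semialgebraic `S ⊆ (−1,1) × (−1,1]`, and of the kill potential in kill
  coordinates `Ξ(u₁,u₀)` and its `x`-derivative `S(u₁,u₀)κ(u₁)κ'(u₀)` on `S ⊆ (−1,1) × (−1,1]`
  (rational functions of `u₀, u₁, m` and four inverse square roots of polynomials positive on the
  parameter box `(−1,1)² × (0,1)`, pulled back along `w ↦ (w, m)`; the closed faces `w₁ = 1`,
  `u₁ = 1` glued on, where everything vanishes since `(√0)⁻¹ = 0`);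
* absolute integrability of the two derivatives on semialgebraic `S ⊆ (0,1) × [s₁,1]`, resp.
  `S ⊆ (s₁,1) × [0,1]` (`0 < s₁ < 1`), from the dominations of file II with `d = (1−m)s₁²`;
* the bound `|Ψ(x,s)| ≤ d⁻¹(√(1−x))⁻¹(√(1−m))⁻¹`.

References: M. Kontsevich, D. Zagier, *Periods* (2001), §1.2; this work (solo-informed s41).
-/

noncomputable section

open MeasureTheory Set Filter
open scoped Classical

open Literature.NumberTheory.Transcendental Literature.NumberTheory.Transcendental.KZ
open Literature.ModelTheory.ExponentialFields

namespace Summit.KontsevichZagierPeriods.KontsevichZagierPeriods.Theorems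

/-! ### Semialgebraicity on the parameter box `(−1,1) × (−1,1) × (0,1)` -/

/-- On the parameter box all radicands (both moduli) and both denominators are positive.
[folklore] -/
theorem soloInformed_kummerHeuman_box3_pos {u : Fin 3 → ℝ}
    (hu : u ∈ {u : Fin 3 → ℝ | u 0 ∈ Ioo (-1:ℝ) 1 ∧ u 1 ∈ Ioo (-1:ℝ) 1 ∧ u 2 ∈ Ioo (0:ℝ) 1}) :
    ((0 < 1 - u 0 ^ 2 ∧ 0 < 1 - u 2 * u 0 ^ 2) ∧ (0 < 1 - u 1 ^ 2 ∧ 0 < 1 - u 2 * u 1 ^ 2)) ∧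
    ((0 < 1 - u 0 ^ 2 ∧ 0 < 1 - (1 - u 2) * u 0 ^ 2) ∧
      (0 < 1 - u 1 ^ 2 ∧ 0 < 1 - (1 - u 2) * u 1 ^ 2)) ∧
    (0 < 1 - (1 - (1 - u 2) * u 1 ^ 2) * u 0 ^ 2 ∧ 0 < 1 - (1 - (1 - u 2) * u 0 ^ 2) * u 1 ^ 2) := by
  obtain ⟨h0, h1, h2⟩ := hu
  have ha : u 0 ^ 2 < 1 := by nlinarith [h0.1, h0.2]
  have hb : u 1 ^ 2 < 1 := by nlinarith [h1.1, h1.2]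
  have h2' := soloInformed_kummerHeuman_compl h2
  exact ⟨⟨soloInformed_kummerZeta_radicands_pos h2 ha, soloInformed_kummerZeta_radicands_pos h2 hb⟩,
    ⟨soloInformed_kummerZeta_radicands_pos h2' ha, soloInformed_kummerZeta_radicands_pos h2' hb⟩,
    ⟨soloInformed_kummerHeuman_denom_pos h2 ha, soloInformed_kummerHeuman_denom_pos h2 hb⟩⟩

/-- The kernel `κ_{u₂}(u_i) κ'_{1−u₂}(u_j)` is `ℚ`-semialgebraic on the parameter box, for
`(i,j) = (0,1)` (deformation coordinates) and `(1,0)` (kill coordinates). [this work] -/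
theorem soloInformed_kummerHeuman_sa3_kernel (i j : Fin 3) (hij : (i = 0 ∧ j = 1) ∨ (i = 1 ∧ j = 0)) :
    IsSemialgebraicFunOn ℚ {u : Fin 3 → ℝ | u 0 ∈ Ioo (-1:ℝ) 1 ∧ u 1 ∈ Ioo (-1:ℝ) 1 ∧
      u 2 ∈ Ioo (0:ℝ) 1}
      (fun u => (√(1 - u i ^ 2))⁻¹ * (√(1 - u 2 * u i ^ 2))⁻¹ *
        ((√(1 - u j ^ 2))⁻¹ * (√(1 - (1 - u 2) * u j ^ 2))⁻¹)) := by
  have hT := soloInformed_kummerZeta_isSemialgebraic_box3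
  have hpos : ∀ u ∈ {u : Fin 3 → ℝ | u 0 ∈ Ioo (-1:ℝ) 1 ∧ u 1 ∈ Ioo (-1:ℝ) 1 ∧ u 2 ∈ Ioo (0:ℝ) 1},
      (0 < 1 - u i ^ 2 ∧ 0 < 1 - u 2 * u i ^ 2) ∧ (0 < 1 - u j ^ 2 ∧ 0 < 1 - (1 - u 2) * u j ^ 2) := by
    intro u hu
    have h := soloInformed_kummerHeuman_box3_pos hu
    rcases hij with ⟨hi, hj⟩ | ⟨hi, hj⟩ <;> subst hi <;> subst hj
    exacts [⟨h.1.1, h.2.1.2⟩, ⟨h.1.2, h.2.1.1⟩]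
  have h1 := soloInformed_sa_inv_sqrt_aeval hT (1 - MvPolynomial.X i ^ 2) fun u hu => by
    simpa only [map_sub, map_one, map_pow, map_mul, MvPolynomial.aeval_X] using (hpos u hu).1.1
  have h2 := soloInformed_sa_inv_sqrt_aeval hT (1 - MvPolynomial.X 2 * MvPolynomial.X i ^ 2)
    fun u hu => by
    simpa only [map_sub, map_one, map_pow, map_mul, MvPolynomial.aeval_X] using (hpos u hu).1.2
  have h3 := soloInformed_sa_inv_sqrt_aeval hT (1 - MvPolynomial.X j ^ 2) fun u hu => by
    simpa only [map_sub, map_one, map_pow, map_mul, MvPolynomial.aeval_X] using (hpos u hu).2.1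
  have h4 := soloInformed_sa_inv_sqrt_aeval hT (1 - (1 - MvPolynomial.X 2) * MvPolynomial.X j ^ 2)
    fun u hu => by
    simpa only [map_sub, map_one, map_pow, map_mul, MvPolynomial.aeval_X] using (hpos u hu).2.2
  refine (IsSemialgebraicFunOn.mul_holds (IsSemialgebraicFunOn.mul_holds h1 h2)
    (IsSemialgebraicFunOn.mul_holds h3 h4)).congr fun u _ => ?_
  simp only [Pi.mul_apply, map_sub, map_one, map_pow, map_mul, MvPolynomial.aeval_X]

/-- `R` over a common denominator. [this work] -/
theorem soloInformed_kummerHeuman_R_eq (m x s : ℝ) :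
    soloInformedKummerHeumanR m x s =
      (1 - m) * x ^ 2 * ((1 - 2 * (1 + (1 - m)) * s ^ 2 + 3 * (1 - m) * s ^ 4) *
          (1 - (1 - (1 - m) * s ^ 2) * x ^ 2) -
        2 * (1 - m) * s ^ 2 * x ^ 2 * ((1 - s ^ 2) * (1 - (1 - m) * s ^ 2))) /
        (1 - (1 - (1 - m) * s ^ 2) * x ^ 2) ^ 2 := by
  unfold soloInformedKummerHeumanR
  field_simp

/-- `S` over a common denominator. [this work] -/
theorem soloInformed_kummerHeuman_S_eq {m x s : ℝ} (hD : 1 - (1 - (1 - m) * s ^ 2) * x ^ 2 ≠ 0) :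
    soloInformedKummerHeumanS m x s =
      (1 - (1 - m) * s ^ 2) * ((1 - 2 * (1 + m) * x ^ 2 + 3 * m * x ^ 4) *
          (1 - (1 - (1 - m) * s ^ 2) * x ^ 2) +
        2 * (1 - (1 - m) * s ^ 2) * x ^ 2 * ((1 - x ^ 2) * (1 - m * x ^ 2))) /
        (1 - (1 - (1 - m) * s ^ 2) * x ^ 2) ^ 2 := by
  unfold soloInformedKummerHeumanS
  field_simp

/-- The deformation potential `Ψ(u₂; u₀, u₁)` is `ℚ`-semialgebraic on the parameter box.
[this work] -/
theorem soloInformed_kummerHeuman_sa3_Psi :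
    IsSemialgebraicFunOn ℚ {u : Fin 3 → ℝ | u 0 ∈ Ioo (-1:ℝ) 1 ∧ u 1 ∈ Ioo (-1:ℝ) 1 ∧
      u 2 ∈ Ioo (0:ℝ) 1} (fun u => soloInformedKummerHeumanPsi (u 2) (u 0) (u 1)) := by
  have hT := soloInformed_kummerZeta_isSemialgebraic_box3
  have hq : ∀ u ∈ {u : Fin 3 → ℝ | u 0 ∈ Ioo (-1:ℝ) 1 ∧ u 1 ∈ Ioo (-1:ℝ) 1 ∧ u 2 ∈ Ioo (0:ℝ) 1},
      MvPolynomial.aeval u (1 - (1 - (1 - MvPolynomial.X 2) * MvPolynomial.X 1 ^ 2) *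
        MvPolynomial.X 0 ^ 2 : MvPolynomial (Fin 3) ℚ) ≠ 0 := fun u hu => by
    simpa only [map_sub, map_one, map_pow, map_mul, MvPolynomial.aeval_X] using
      (soloInformed_kummerHeuman_box3_pos hu).2.2.1.ne'
  refine ((isSemialgebraicFunOn_aeval_div_aeval hT
    ((1 - MvPolynomial.X 2) * MvPolynomial.X 0 ^ 2 * (MvPolynomial.X 1 *
      ((1 - MvPolynomial.X 1 ^ 2) * (1 - (1 - MvPolynomial.X 2) * MvPolynomial.X 1 ^ 2))))
    (1 - (1 - (1 - MvPolynomial.X 2) * MvPolynomial.X 1 ^ 2) * MvPolynomial.X 0 ^ 2) hq).mul_holds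
    (soloInformed_kummerHeuman_sa3_kernel 0 1 (Or.inl ⟨rfl, rfl⟩))).congr fun u _ => ?_
  simp only [Pi.mul_apply, map_sub, map_one, map_pow, map_mul, MvPolynomial.aeval_X,
    soloInformedKummerHeumanPsi]
  ring

/-- The `s`-derivative `R(u₀,u₁)κ(u₀)κ'(u₁)` (modulus `u₂`) is `ℚ`-semialgebraic on the parameter
box. [this work] -/
theorem soloInformed_kummerHeuman_sa3_gR :
    IsSemialgebraicFunOn ℚ {u : Fin 3 → ℝ | u 0 ∈ Ioo (-1:ℝ) 1 ∧ u 1 ∈ Ioo (-1:ℝ) 1 ∧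
      u 2 ∈ Ioo (0:ℝ) 1}
      (fun u => soloInformedKummerHeumanR (u 2) (u 0) (u 1) *
        ((√(1 - u 0 ^ 2))⁻¹ * (√(1 - u 2 * u 0 ^ 2))⁻¹) *
        ((√(1 - u 1 ^ 2))⁻¹ * (√(1 - (1 - u 2) * u 1 ^ 2))⁻¹)) := by
  have hT := soloInformed_kummerZeta_isSemialgebraic_box3
  have hq : ∀ u ∈ {u : Fin 3 → ℝ | u 0 ∈ Ioo (-1:ℝ) 1 ∧ u 1 ∈ Ioo (-1:ℝ) 1 ∧ u 2 ∈ Ioo (0:ℝ) 1},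
      MvPolynomial.aeval u ((1 - (1 - (1 - MvPolynomial.X 2) * MvPolynomial.X 1 ^ 2) *
        MvPolynomial.X 0 ^ 2) ^ 2 : MvPolynomial (Fin 3) ℚ) ≠ 0 := fun u hu => by
    simpa only [map_sub, map_one, map_pow, map_mul, MvPolynomial.aeval_X] using
      pow_ne_zero 2 (soloInformed_kummerHeuman_box3_pos hu).2.2.1.ne'
  refine ((isSemialgebraicFunOn_aeval_div_aeval hT
    ((1 - MvPolynomial.X 2) * MvPolynomial.X 0 ^ 2 *
      ((1 - 2 * (1 + (1 - MvPolynomial.X 2)) * MvPolynomial.X 1 ^ 2 +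
          3 * (1 - MvPolynomial.X 2) * MvPolynomial.X 1 ^ 4) *
          (1 - (1 - (1 - MvPolynomial.X 2) * MvPolynomial.X 1 ^ 2) * MvPolynomial.X 0 ^ 2) -
        2 * (1 - MvPolynomial.X 2) * MvPolynomial.X 1 ^ 2 * MvPolynomial.X 0 ^ 2 *
          ((1 - MvPolynomial.X 1 ^ 2) * (1 - (1 - MvPolynomial.X 2) * MvPolynomial.X 1 ^ 2))))
    ((1 - (1 - (1 - MvPolynomial.X 2) * MvPolynomial.X 1 ^ 2) * MvPolynomial.X 0 ^ 2) ^ 2)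
    hq).mul_holds (soloInformed_kummerHeuman_sa3_kernel 0 1 (Or.inl ⟨rfl, rfl⟩))).congr
    fun u _ => ?_
  simp only [Pi.mul_apply, map_sub, map_add, map_one, map_pow, map_mul, map_ofNat,
    MvPolynomial.aeval_X]
  rw [soloInformed_kummerHeuman_R_eq]
  ring

/-- The kill potential in kill coordinates, `Ξ(u₂; u₁, u₀)` (`x = u₁`, `s = u₀`), is
`ℚ`-semialgebraic on the parameter box. [this work] -/
theorem soloInformed_kummerHeuman_sa3_Xi :
    IsSemialgebraicFunOn ℚ {u : Fin 3 → ℝ | u 0 ∈ Ioo (-1:ℝ) 1 ∧ u 1 ∈ Ioo (-1:ℝ) 1 ∧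
      u 2 ∈ Ioo (0:ℝ) 1} (fun u => soloInformedKummerHeumanXi (u 2) (u 1) (u 0)) := by
  have hT := soloInformed_kummerZeta_isSemialgebraic_box3
  have hq : ∀ u ∈ {u : Fin 3 → ℝ | u 0 ∈ Ioo (-1:ℝ) 1 ∧ u 1 ∈ Ioo (-1:ℝ) 1 ∧ u 2 ∈ Ioo (0:ℝ) 1},
      MvPolynomial.aeval u (1 - (1 - (1 - MvPolynomial.X 2) * MvPolynomial.X 0 ^ 2) *
        MvPolynomial.X 1 ^ 2 : MvPolynomial (Fin 3) ℚ) ≠ 0 := fun u hu => by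
    simpa only [map_sub, map_one, map_pow, map_mul, MvPolynomial.aeval_X] using
      (soloInformed_kummerHeuman_box3_pos hu).2.2.2.ne'
  refine ((isSemialgebraicFunOn_aeval_div_aeval hT
    (MvPolynomial.X 1 * ((1 - MvPolynomial.X 1 ^ 2) * (1 - MvPolynomial.X 2 * MvPolynomial.X 1 ^ 2)) *
      (1 - (1 - MvPolynomial.X 2) * MvPolynomial.X 0 ^ 2))
    (1 - (1 - (1 - MvPolynomial.X 2) * MvPolynomial.X 0 ^ 2) * MvPolynomial.X 1 ^ 2) hq).mul_holds
    (soloInformed_kummerHeuman_sa3_kernel 1 0 (Or.inr ⟨rfl, rfl⟩))).congr fun u _ => ?_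
  simp only [Pi.mul_apply, map_sub, map_one, map_pow, map_mul, MvPolynomial.aeval_X,
    soloInformedKummerHeumanXi]
  ring

/-- The `x`-derivative in kill coordinates, `S(u₁,u₀)κ(u₁)κ'(u₀)` (modulus `u₂`), is
`ℚ`-semialgebraic on the parameter box. [this work] -/
theorem soloInformed_kummerHeuman_sa3_gS :
    IsSemialgebraicFunOn ℚ {u : Fin 3 → ℝ | u 0 ∈ Ioo (-1:ℝ) 1 ∧ u 1 ∈ Ioo (-1:ℝ) 1 ∧
      u 2 ∈ Ioo (0:ℝ) 1}
      (fun u => soloInformedKummerHeumanS (u 2) (u 1) (u 0) *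
        ((√(1 - u 1 ^ 2))⁻¹ * (√(1 - u 2 * u 1 ^ 2))⁻¹) *
        ((√(1 - u 0 ^ 2))⁻¹ * (√(1 - (1 - u 2) * u 0 ^ 2))⁻¹)) := by
  have hT := soloInformed_kummerZeta_isSemialgebraic_box3
  have hq : ∀ u ∈ {u : Fin 3 → ℝ | u 0 ∈ Ioo (-1:ℝ) 1 ∧ u 1 ∈ Ioo (-1:ℝ) 1 ∧ u 2 ∈ Ioo (0:ℝ) 1},
      MvPolynomial.aeval u ((1 - (1 - (1 - MvPolynomial.X 2) * MvPolynomial.X 0 ^ 2) *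
        MvPolynomial.X 1 ^ 2) ^ 2 : MvPolynomial (Fin 3) ℚ) ≠ 0 := fun u hu => by
    simpa only [map_sub, map_one, map_pow, map_mul, MvPolynomial.aeval_X] using
      pow_ne_zero 2 (soloInformed_kummerHeuman_box3_pos hu).2.2.2.ne'
  refine ((isSemialgebraicFunOn_aeval_div_aeval hT
    ((1 - (1 - MvPolynomial.X 2) * MvPolynomial.X 0 ^ 2) *
      ((1 - 2 * (1 + MvPolynomial.X 2) * MvPolynomial.X 1 ^ 2 + 3 * MvPolynomial.X 2 *
          MvPolynomial.X 1 ^ 4) *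
          (1 - (1 - (1 - MvPolynomial.X 2) * MvPolynomial.X 0 ^ 2) * MvPolynomial.X 1 ^ 2) +
        2 * (1 - (1 - MvPolynomial.X 2) * MvPolynomial.X 0 ^ 2) * MvPolynomial.X 1 ^ 2 *
          ((1 - MvPolynomial.X 1 ^ 2) * (1 - MvPolynomial.X 2 * MvPolynomial.X 1 ^ 2))))
    ((1 - (1 - (1 - MvPolynomial.X 2) * MvPolynomial.X 0 ^ 2) * MvPolynomial.X 1 ^ 2) ^ 2)
    hq).mul_holds (soloInformed_kummerHeuman_sa3_kernel 1 0 (Or.inr ⟨rfl, rfl⟩))).congr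
    fun u hu => ?_
  have hS := soloInformed_kummerHeuman_S_eq (soloInformed_kummerHeuman_box3_pos hu).2.2.2.ne'
  simp only [Pi.mul_apply, map_sub, map_add, map_one, map_pow, map_mul, map_ofNat,
    MvPolynomial.aeval_X]
  rw [hS]
  ring

/-! ### Semialgebraicity in the plane, modulus fixed -/

/-- For `m ∈ (0,1)` algebraic and semialgebraic `S ⊆ (−1,1)²`: `Ψ(w₀,w₁)`, `R(w₀,w₁)κ(w₀)κ'(w₁)`,
`Ξ(w₁,w₀)` and `S(w₁,w₀)κ(w₁)κ'(w₀)` are `ℚ`-semialgebraic on `S` (pull back along `w ↦ (w, m)`).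
[this work] -/
theorem soloInformed_kummerHeuman_sa_two {m : ℝ} (hm : m ∈ Ioo (0:ℝ) 1) (hma : IsAlgebraic ℚ m)
    {S : Set (Fin 2 → ℝ)} (hS : IsSemialgebraic ℚ S)
    (hw : ∀ w ∈ S, w 0 ∈ Ioo (-1:ℝ) 1 ∧ w 1 ∈ Ioo (-1:ℝ) 1) :
    IsSemialgebraicFunOn ℚ S (fun w => soloInformedKummerHeumanPsi m (w 0) (w 1)) ∧
    IsSemialgebraicFunOn ℚ S (fun w => soloInformedKummerHeumanR m (w 0) (w 1) *
      ((√(1 - w 0 ^ 2))⁻¹ * (√(1 - m * w 0 ^ 2))⁻¹) *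
      ((√(1 - w 1 ^ 2))⁻¹ * (√(1 - (1 - m) * w 1 ^ 2))⁻¹)) ∧
    IsSemialgebraicFunOn ℚ S (fun w => soloInformedKummerHeumanXi m (w 1) (w 0)) ∧
    IsSemialgebraicFunOn ℚ S (fun w => soloInformedKummerHeumanS m (w 1) (w 0) *
      ((√(1 - w 1 ^ 2))⁻¹ * (√(1 - m * w 1 ^ 2))⁻¹) *
      ((√(1 - w 0 ^ 2))⁻¹ * (√(1 - (1 - m) * w 0 ^ 2))⁻¹)) := by
  have hφ : IsSemialgebraicMapOn ℚ S (fun w => (Fin.snoc w m : Fin 3 → ℝ)) := by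
    refine IsSemialgebraicMapOn.of_forall hS fun j => ?_
    induction j using Fin.lastCases with
    | last => simp only [Fin.snoc_last]; exact isSemialgebraicFunOn_const_of_isAlgebraic hS hma
    | cast i => simp only [Fin.snoc_castSucc]; exact isSemialgebraicFunOn_apply hS i
  have hmaps : MapsTo (fun w => (Fin.snoc w m : Fin 3 → ℝ)) S
      {u : Fin 3 → ℝ | u 0 ∈ Ioo (-1:ℝ) 1 ∧ u 1 ∈ Ioo (-1:ℝ) 1 ∧ u 2 ∈ Ioo (0:ℝ) 1} :=
    fun w hwS => ⟨(hw w hwS).1, (hw w hwS).2, hm⟩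
  exact ⟨(soloInformed_kummerHeuman_sa3_Psi.comp_isSemialgebraicMapOn_holds hφ hmaps).congr
      fun w _ => rfl,
    (soloInformed_kummerHeuman_sa3_gR.comp_isSemialgebraicMapOn_holds hφ hmaps).congr fun w _ => rfl,
    (soloInformed_kummerHeuman_sa3_Xi.comp_isSemialgebraicMapOn_holds hφ hmaps).congr fun w _ => rfl,
    (soloInformed_kummerHeuman_sa3_gS.comp_isSemialgebraicMapOn_holds hφ hmaps).congr fun w _ => rfl⟩

/-- Closed-range version: `S ⊆ (−1,1) × (−1,1]`; on the face `w₁ = 1` all four functions vanish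
(`Ψ(x,1) = 0`, `Ξ(1,s) = 0`, `(√0)⁻¹ = 0`). [this work] -/
theorem soloInformed_kummerHeuman_sa_two' {m : ℝ} (hm : m ∈ Ioo (0:ℝ) 1) (hma : IsAlgebraic ℚ m)
    {S : Set (Fin 2 → ℝ)} (hS : IsSemialgebraic ℚ S)
    (hw : ∀ w ∈ S, w 0 ∈ Ioo (-1:ℝ) 1 ∧ -1 < w 1 ∧ w 1 ≤ 1) :
    IsSemialgebraicFunOn ℚ S (fun w => soloInformedKummerHeumanPsi m (w 0) (w 1)) ∧
    IsSemialgebraicFunOn ℚ S (fun w => soloInformedKummerHeumanR m (w 0) (w 1) *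
      ((√(1 - w 0 ^ 2))⁻¹ * (√(1 - m * w 0 ^ 2))⁻¹) *
      ((√(1 - w 1 ^ 2))⁻¹ * (√(1 - (1 - m) * w 1 ^ 2))⁻¹)) ∧
    IsSemialgebraicFunOn ℚ S (fun w => soloInformedKummerHeumanXi m (w 1) (w 0)) ∧
    IsSemialgebraicFunOn ℚ S (fun w => soloInformedKummerHeumanS m (w 1) (w 0) *
      ((√(1 - w 1 ^ 2))⁻¹ * (√(1 - m * w 1 ^ 2))⁻¹) *
      ((√(1 - w 0 ^ 2))⁻¹ * (√(1 - (1 - m) * w 0 ^ 2))⁻¹)) := by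
  have hS' := hS.inter (isSemialgebraic_setOf_apply_lt_const (n := 2) isAlgebraic_one 1)
  obtain ⟨hP, hg, hX, hh⟩ := soloInformed_kummerHeuman_sa_two hm hma hS'
    fun w hw' => ⟨(hw w hw'.1).1, (hw w hw'.1).2.1, hw'.2⟩
  have hle : ∀ w ∈ S, w 1 ≤ 1 := fun w hwS => (hw w hwS).2.2
  refine ⟨soloInformed_kummerZeta_sa_face hS hP (fun w _ hw1 => ?_) hle,
    soloInformed_kummerZeta_sa_face hS hg (fun w _ hw1 => ?_) hle,
    soloInformed_kummerZeta_sa_face hS hX (fun w _ hw1 => ?_) hle,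
    soloInformed_kummerZeta_sa_face hS hh (fun w _ hw1 => ?_) hle⟩
  · rw [hw1]; exact soloInformed_kummerHeumanPsi_right_one m (w 0)
  · rw [hw1]; simp
  · rw [hw1]; exact soloInformed_kummerHeumanXi_left_one m (w 0)
  · rw [hw1]; simp

/-! ### Integrability on the bands -/

/-- `R(w₀,w₁)κ(w₀)κ'(w₁)` is integrable on every semialgebraic `S ⊆ (0,1) × [s₁,1]`, `0 < s₁ < 1`
(domination with `d = (1−m)s₁²`). [this work] -/
theorem soloInformed_kummerHeuman_integrableOn_gR {m s₁ : ℝ} (hm : m ∈ Ioo (0:ℝ) 1)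
    (hma : IsAlgebraic ℚ m) (hs₁ : s₁ ∈ Ioo (0:ℝ) 1) {S : Set (Fin 2 → ℝ)}
    (hS : IsSemialgebraic ℚ S) (hw : ∀ w ∈ S, w 0 ∈ Ioo (0:ℝ) 1 ∧ w 1 ∈ Icc s₁ 1) :
    IntegrableOn (fun w : Fin 2 → ℝ => soloInformedKummerHeumanR m (w 0) (w 1) *
      ((√(1 - w 0 ^ 2))⁻¹ * (√(1 - m * w 0 ^ 2))⁻¹) *
      ((√(1 - w 1 ^ 2))⁻¹ * (√(1 - (1 - m) * w 1 ^ 2))⁻¹)) S := by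
  have hg := (soloInformed_kummerHeuman_sa_two' hm hma hS fun w hwS =>
    ⟨⟨by linarith [(hw w hwS).1.1], (hw w hwS).1.2⟩, by linarith [(hw w hwS).2.1, hs₁.1],
      (hw w hwS).2.2⟩).2.1
  have hd : 0 < (1 - m) * s₁ ^ 2 := mul_pos (by linarith [hm.2]) (pow_pos hs₁.1 2)
  set C : ℝ := 6 / ((1 - m) * s₁ ^ 2) ^ 2 * ((√(1 - m))⁻¹ * (√m)⁻¹) with hCdef
  have hC6 : (0:ℝ) ≤ 6 / ((1 - m) * s₁ ^ 2) ^ 2 := by positivity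
  have hC : 0 ≤ C := by positivity
  refine soloInformed_integrableOn_of_le_inv_sqrt_prod hS hg ∅ {0, 1} ∅ {0, 1} C {w | w 1 = 1}
    (by rw [volume_pi]; exact Measure.pi_hyperplane _ 1 1)
    (fun w hwS hZ j => ?_) (fun w hwS hc => ?_)
  · simp only [mem_setOf_eq] at hZ
    fin_cases j
    · exact (hw w hwS).1
    · exact ⟨hs₁.1.trans_le (hw w hwS).2.1, lt_of_le_of_ne (hw w hwS).2.2 hZ⟩
  · have ha := hc 0
    have hb := hc 1
    have hx2 : w 0 ^ 2 ≤ 1 := by nlinarith [ha.1, ha.2]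
    have hb2 : w 1 ^ 2 ≤ 1 := by nlinarith [hb.1, hb.2]
    have hdD := (soloInformed_kummerHeuman_denom_ge hm hx2 hs₁.1.le (hw w hwS).2.1 hb.2.le).1
    have hR := soloInformed_kummerHeuman_abs_R_le hm hx2 hb2 hd hdD
    have hK := soloInformed_kummerHeuman_kernel_le hm ⟨ha.1.le, ha.2⟩ ⟨hb.1.le, hb.2⟩ hR hC6
    have hX : 0 ≤ (√(1 - w 0))⁻¹ * (√(1 - w 1))⁻¹ := by positivity
    rw [Finset.prod_empty, Finset.prod_pair (by decide), one_mul]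
    calc |soloInformedKummerHeumanR m (w 0) (w 1) * ((√(1 - w 0 ^ 2))⁻¹ * (√(1 - m * w 0 ^ 2))⁻¹) *
          ((√(1 - w 1 ^ 2))⁻¹ * (√(1 - (1 - m) * w 1 ^ 2))⁻¹)|
        ≤ C * ((√(1 - w 0))⁻¹ * (√(1 - w 1))⁻¹) := hK
      _ ≤ C * ((√(1 - w 0))⁻¹ * (√(1 - w 1))⁻¹ + (√(1 - w 0))⁻¹ * (√(1 - w 1))⁻¹) := by
          nlinarith [mul_nonneg hC hX]

/-- `S(u₁,u₀)κ(u₁)κ'(u₀)` is integrable on every semialgebraic `S ⊆ (s₁,1) × [0,1]`, `0 < s₁ < 1`.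
[this work] -/
theorem soloInformed_kummerHeuman_integrableOn_gS {m s₁ : ℝ} (hm : m ∈ Ioo (0:ℝ) 1)
    (hma : IsAlgebraic ℚ m) (hs₁ : s₁ ∈ Ioo (0:ℝ) 1) {S : Set (Fin 2 → ℝ)}
    (hS : IsSemialgebraic ℚ S) (hw : ∀ w ∈ S, w 0 ∈ Ioo s₁ 1 ∧ w 1 ∈ Icc (0:ℝ) 1) :
    IntegrableOn (fun w : Fin 2 → ℝ => soloInformedKummerHeumanS m (w 1) (w 0) *
      ((√(1 - w 1 ^ 2))⁻¹ * (√(1 - m * w 1 ^ 2))⁻¹) *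
      ((√(1 - w 0 ^ 2))⁻¹ * (√(1 - (1 - m) * w 0 ^ 2))⁻¹)) S := by
  have hg := (soloInformed_kummerHeuman_sa_two' hm hma hS fun w hwS =>
    ⟨⟨by linarith [(hw w hwS).1.1, hs₁.1], (hw w hwS).1.2⟩, by linarith [(hw w hwS).2.1],
      (hw w hwS).2.2⟩).2.2.2
  have hd : 0 < (1 - m) * s₁ ^ 2 := mul_pos (by linarith [hm.2]) (pow_pos hs₁.1 2)
  set C : ℝ := 6 / ((1 - m) * s₁ ^ 2) ^ 2 * ((√(1 - m))⁻¹ * (√m)⁻¹) with hCdef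
  have hC6 : (0:ℝ) ≤ 6 / ((1 - m) * s₁ ^ 2) ^ 2 := by positivity
  have hC : 0 ≤ C := by positivity
  refine soloInformed_integrableOn_of_le_inv_sqrt_prod hS hg ∅ {0, 1} ∅ {0, 1} C
    ({w | w 1 = 0} ∪ {w | w 1 = 1})
    (measure_union_null (by rw [volume_pi]; exact Measure.pi_hyperplane _ 1 0)
      (by rw [volume_pi]; exact Measure.pi_hyperplane _ 1 1))
    (fun w hwS hZ j => ?_) (fun w hwS hc => ?_)
  · simp only [mem_union, mem_setOf_eq, not_or] at hZ
    fin_cases j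
    · exact ⟨hs₁.1.trans (hw w hwS).1.1, (hw w hwS).1.2⟩
    · exact ⟨lt_of_le_of_ne (hw w hwS).2.1 (Ne.symm hZ.1), lt_of_le_of_ne (hw w hwS).2.2 hZ.2⟩
  · have ha := hc 0
    have hb := hc 1
    have hx2 : w 1 ^ 2 ≤ 1 := by nlinarith [hb.1, hb.2]
    have hs2 : w 0 ^ 2 ≤ 1 := by nlinarith [ha.1, ha.2]
    have hdD := (soloInformed_kummerHeuman_denom_ge hm hx2 hs₁.1.le (hw w hwS).1.1.le ha.2.le).1
    have hSle := soloInformed_kummerHeuman_abs_S_le hm hx2 hs2 hd hdD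
    have hK := soloInformed_kummerHeuman_kernel_le hm ⟨hb.1.le, hb.2⟩ ⟨ha.1.le, ha.2⟩ hSle hC6
    have hX : 0 ≤ (√(1 - w 0))⁻¹ * (√(1 - w 1))⁻¹ := by positivity
    rw [Finset.prod_empty, Finset.prod_pair (by decide), one_mul]
    calc |soloInformedKummerHeumanS m (w 1) (w 0) * ((√(1 - w 1 ^ 2))⁻¹ * (√(1 - m * w 1 ^ 2))⁻¹) *
          ((√(1 - w 0 ^ 2))⁻¹ * (√(1 - (1 - m) * w 0 ^ 2))⁻¹)|
        ≤ C * ((√(1 - w 1))⁻¹ * (√(1 - w 0))⁻¹) := hK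
      _ = C * ((√(1 - w 0))⁻¹ * (√(1 - w 1))⁻¹) := by ring
      _ ≤ C * ((√(1 - w 0))⁻¹ * (√(1 - w 1))⁻¹ + (√(1 - w 0))⁻¹ * (√(1 - w 1))⁻¹) := by
          nlinarith [mul_nonneg hC hX]

/-- `|Ψ(x,s)| ≤ d⁻¹(√(1−x))⁻¹(√(1−m))⁻¹` for `x ∈ [0,1)`, `s ∈ [0,1]`, `0 < d ≤ D`. [this work] -/
theorem soloInformed_kummerHeumanPsi_abs_le {m x s d : ℝ} (hm : m ∈ Ioo (0:ℝ) 1)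
    (hx : x ∈ Ico (0:ℝ) 1) (hs : s ∈ Icc (0:ℝ) 1) (hd : 0 < d)
    (hdD : d ≤ 1 - (1 - (1 - m) * s ^ 2) * x ^ 2) :
    |soloInformedKummerHeumanPsi m x s| ≤ d⁻¹ * ((√(1 - x))⁻¹ * (√(1 - m))⁻¹) := by
  have hm' := soloInformed_kummerHeuman_compl hm
  have hD : 0 < 1 - (1 - (1 - m) * s ^ 2) * x ^ 2 := hd.trans_le hdD
  have hκ := soloInformed_kummerZeta_kappa_le hm hx
  have hκ0 : 0 ≤ (√(1 - x ^ 2))⁻¹ * (√(1 - m * x ^ 2))⁻¹ := by positivity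
  have hmx0 : 0 ≤ (1 - m) * x ^ 2 := mul_nonneg hm'.1.le (sq_nonneg x)
  have hmx1 : (1 - m) * x ^ 2 ≤ 1 := by nlinarith [hm'.2, hx.1, hx.2]
  have hs1 : √(1 - s ^ 2) ≤ 1 := by
    rw [show (1:ℝ) = √1 from Real.sqrt_one.symm]
    exact Real.sqrt_le_sqrt (by rw [Real.sqrt_one]; nlinarith)
  have hs2 : √(1 - (1 - m) * s ^ 2) ≤ 1 := by
    rw [show (1:ℝ) = √1 from Real.sqrt_one.symm]
    exact Real.sqrt_le_sqrt (by rw [Real.sqrt_one]; nlinarith [mul_nonneg hm'.1.le (sq_nonneg s)])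
  have hn0 : 0 ≤ s * (√(1 - s ^ 2) * √(1 - (1 - m) * s ^ 2)) :=
    mul_nonneg hs.1 (mul_nonneg (Real.sqrt_nonneg _) (Real.sqrt_nonneg _))
  have hn1 : s * (√(1 - s ^ 2) * √(1 - (1 - m) * s ^ 2)) ≤ 1 := by
    calc s * (√(1 - s ^ 2) * √(1 - (1 - m) * s ^ 2)) ≤ 1 * (1 * 1) :=
          mul_le_mul hs.2 (mul_le_mul hs1 hs2 (Real.sqrt_nonneg _) zero_le_one)
            (mul_nonneg (Real.sqrt_nonneg _) (Real.sqrt_nonneg _)) zero_le_one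
      _ = 1 := by ring
  have hq0 : 0 ≤ s * (√(1 - s ^ 2) * √(1 - (1 - m) * s ^ 2)) /
      (1 - (1 - (1 - m) * s ^ 2) * x ^ 2) := div_nonneg hn0 hD.le
  have hq : s * (√(1 - s ^ 2) * √(1 - (1 - m) * s ^ 2)) / (1 - (1 - (1 - m) * s ^ 2) * x ^ 2) ≤
      d⁻¹ := by
    rw [div_le_iff₀ hD]
    calc s * (√(1 - s ^ 2) * √(1 - (1 - m) * s ^ 2)) ≤ 1 := hn1
      _ = d⁻¹ * d := (inv_mul_cancel₀ hd.ne').symm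
      _ ≤ d⁻¹ * (1 - (1 - (1 - m) * s ^ 2) * x ^ 2) :=
          mul_le_mul_of_nonneg_left hdD (inv_nonneg.2 hd.le)
  rw [soloInformed_kummerHeumanPsi_eq_sqrt,
    abs_of_nonneg (mul_nonneg (mul_nonneg hmx0 hκ0) hq0)]
  calc (1 - m) * x ^ 2 * ((√(1 - x ^ 2))⁻¹ * (√(1 - m * x ^ 2))⁻¹) *
        (s * (√(1 - s ^ 2) * √(1 - (1 - m) * s ^ 2)) / (1 - (1 - (1 - m) * s ^ 2) * x ^ 2))
      ≤ 1 * ((√(1 - x))⁻¹ * (√(1 - m))⁻¹) * d⁻¹ :=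
        mul_le_mul (mul_le_mul hmx1 hκ hκ0 zero_le_one) hq hq0 (by positivity)
    _ = d⁻¹ * ((√(1 - x))⁻¹ * (√(1 - m))⁻¹) := by ring

end Summit.KontsevichZagierPeriods.KontsevichZagierPeriods.Theorems
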